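import Summits.QuantumFields.YangMills.Theorems.BalabanUVNodesN15TwoSpacingGluingCutRows
import HarnessLib

/-!
# THE GLUING STEP AT TWO LATTICE SPACINGS, XXVI: THE REMAINDER ROW WITH THE NONLOCAL COMMUTATOR SPLIT BY THE CUBE's CUT AND A MARGIN —
# `[N′, M_h]∘N_□ = M_χ∘[N′, M_h]∘N_□ + M_{1−χ}∘N′∘M_h∘(M_χ∘N_□)`: the first half keeps the commutator's SMALLNESS (`[N′, M_h] = O(w⁻¹)`) behind an OUTPUT cut (where «mirror
# images are farther»), the second is exponentially small in the MARGIN between `supp h` and the complement of `□` ([B6] p.239's `ζ_□` device) (dag-n15-c g12, FILE 68; generic)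

Cell `pub-ymgap`, seat `pub-ymgap-dag-n15-c` (R134 (a); HUMAN RULING D-0062), generation 12.  `bears_on: R4∕N15 · K3⁷ SpineGivenEndpointR13SepCoPH (stmt-QuantumFields-20544)`.
Filed `--supports stmt-QuantumFields-20544 --as helper` — COUNT-NEUTRAL.  Theorems only (0 `def`, 0 `sorry`).  Imports BY NAME FILE 63 `…TwoSpacingGluingCutRows` (through it 43–57); nothing in
the tree is modified.

WHY.  FILE 63's `hasMaj_commOp_comp_of_add_cut` needs a ONE-SIDED letter of the bare cube operator `N_□`, which dag-n15-a's images-extended Neumann cube cannot supply; dag-n15-a's repair N-IIj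
`hasMaj_commOp_comp_of_add_cut_split` bounds the two halves of `[N_L, M_h]∘N_□` SEPARATELY (`c_Kβc_r + β₂`) and so loses the cancellation that makes a commutator with a slowly varying `h`
small — its row cannot feed the smallness `N_ovθ₀c_r < 1`.  THIS FILE keeps the commutator whole where it matters: with `M_h∘M_χ = M_h` (the partition's cut),
`[N′, M_h]∘N = M_χ∘[N′, M_h]∘N + M_{1−χ}∘N′∘M_h∘(M_χ∘N)` EXACTLY (★ `commOp_comp_eq_split_margin`: off the cube `h` vanishes, so there the commutator IS `N′M_h`).  The first half is
dag-n15-a N-IIi `hasMaj_chiCube_comp_neumannCubeG` with `T₁ := [N′, M_h]` (small by FILE 56 `hasMaj_commOp_nonlocal`); the second is ★ `hasMaj_far_sandwich`: `M_{1−χ}∘N′∘M_h ≤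
c_N e^{−(δ_N−ρ₁)g}·e^{−ρ₁d}` when the blocks where `1 − χ ≠ 0` and the blocks where `h ≠ 0` are `≥ g` apart — exponentially small in the margin `g` — composed with the two-sided cut
row of `N` by FILE 63 `hasMaj_comp_exp_in'`.  ★★ `hasMaj_commOp_comp_of_add_cut_margin` assembles FILE 45∕57's input-localized remainder row `≤ 1_S(y′)·(θ₁ + θ₂ + θ₃βc_r)·e^{−ρd}` with
EVERY constant small when the partition varies slowly and the margin is large.
* §1 `mulOp_comp_mulOp_comm`, ★ `commOp_comp_eq_split_margin`; §2 ★ `hasMaj_far_sandwich`; §3 ★★ `hasMaj_commOp_comp_of_add_cut_margin`.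

HONEST FRAMING ∕ LIMITS.  Operator algebra + block-majorant bookkeeping ([B5] (1.121) p.37, (1.128) p.38; [B6] (2.92)–(2.93) p.239, (2.134) p.247 = SHAPES ∕ MECHANISM); nothing of
[B5]∕[B6]∕[B9] asserted.  NE2⁺ NOT PRINTED, NOT proved; N15 NOT discharged; counts of record UNMOVED (typed 28∕28 · discharged 5∕27); one finite 𝕋⁴ at fixed ε — NOT infinite volume,
NOT OS on ℝ⁴, NOT a mass gap, NOT Clay; R4 closes the conditional finite-𝕋⁴ rung `BalabanLadder.UV` only.  Restate-immune (no Theses import).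
-/

noncomputable section

namespace Summit.QuantumFields.YangMills.BalabanUVNodes.N15.Gluing

open Literature.MathematicalPhysics.QuantumFieldTheory.Balaban1983to89
open Literature.MathematicalPhysics.QuantumFieldTheory.Balaban1983to89.B11SectG (BlockNorm HasMaj RowSum hasMaj_comp)
open Literature.MathematicalPhysics.QuantumFieldTheory.Balaban1983to89.T4EtaRateCoeffDefect (diagK diagK_nonneg hasMaj_mulOp)
open Literature.MathematicalPhysics.QuantumFieldTheory.Balaban1983to89.B6RandomWalk (Triangle254)
open Literature.MathematicalPhysics.QuantumFieldTheory.Balaban1983to89.B6Prop26Gluing (mulOp mulOp_apply ind ind_nonneg ind_le_one)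

/-! ## §1 The exact split -/

section Split

variable {X : Type}

/-- multiplications commute. [folklore] -/
theorem mulOp_comp_mulOp_comm (a b : X → ℝ) : mulOp a ∘ₗ mulOp b = mulOp b ∘ₗ mulOp a := by
  rw [mulOp_comp_mulOp, mulOp_comp_mulOp, mul_comm]

/-- ★ **THE SPLIT**: `M_h∘M_χ = M_h` ⟹ `[Δ_loc + N′, M_h]∘N = [Δ_loc, M_h]∘N + (M_χ∘[N′, M_h]∘N + M_{1−χ}∘N′∘M_h∘(M_χ∘N))` — on the complement of the cut `h = 0`, so there `[N′, M_h] = N′∘M_h`.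
[cite: Balaban1984PropagatorsII, (2.92)–(2.93) p.239 (the `ζ_□` split: shape)] -/
theorem commOp_comp_eq_split_margin {Δloc N' N : (X → ℝ) →ₗ[ℝ] (X → ℝ)} {h χ : X → ℝ} (hcut : mulOp h ∘ₗ mulOp χ = mulOp h) :
    commOp (Δloc + N') h ∘ₗ N = commOp Δloc h ∘ₗ N + (mulOp χ ∘ₗ (commOp N' h ∘ₗ N) + mulOp (1 - χ) ∘ₗ (N' ∘ₗ (mulOp h ∘ₗ (mulOp χ ∘ₗ N)))) := by
  have hcut' : mulOp χ ∘ₗ mulOp h = mulOp h := by rw [mulOp_comp_mulOp_comm]; exact hcut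
  rw [commOp_add_left, LinearMap.add_comp]
  congr 1
  refine LinearMap.ext fun f => ?_
  have e1 : mulOp h (mulOp χ (N f)) = mulOp h (N f) := by
    have := LinearMap.congr_fun hcut (N f); simpa only [LinearMap.comp_apply] using this
  have e2 : ∀ v : X → ℝ, mulOp χ (mulOp h v) = mulOp h v := fun v => by
    have := LinearMap.congr_fun hcut' v; simpa only [LinearMap.comp_apply] using this
  simp only [commOp, LinearMap.comp_apply, LinearMap.add_apply, LinearMap.sub_apply, map_sub, e1]
  funext x
  have h2 := congrFun (e2 (N' (N f))) x
  simp only [mulOp_apply, Pi.sub_apply, Pi.add_apply, Pi.one_apply] at h2 ⊢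
  linear_combination h2

end Split

/-! ## §2 The far sandwich: exponentially small in the margin -/

section Far

variable {X : Type} [Fintype X] {g : B6.Geometry} (blk : X → g.Site)

/-- ★ **THE FAR SANDWICH**: `T ≤ c·e^{−δd}`, `|a| ≤ 1` vanishing on the blocks of `A`, `|b| ≤ 1` vanishing off the blocks of `H`, and `d(y, y′) ≥ gap` for `y ∉ A`, `y′ ∈ H` ⟹
`M_a∘T∘M_b ≤ c·e^{−(δ−ρ₁)gap}·e^{−ρ₁d}` (`ρ₁ ≤ δ`). [cite: Balaban1984PropagatorsII, p.239 («ζ_□ … distance ⅓M to the boundary of □»: mechanism)] -/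
theorem hasMaj_far_sandwich {T : (X → ℝ) →ₗ[ℝ] (X → ℝ)} {a b : X → ℝ} {A H : Set g.Site} {c δ ρ₁ gap : ℝ} (hc : 0 ≤ c) (hρδ : ρ₁ ≤ δ) (ha1 : ∀ x, |a x| ≤ 1) (haA : ∀ x, blk x ∈ A → a x = 0) (hb1 : ∀ x, |b x| ≤ 1) (hbH : ∀ x, blk x ∉ H → b x = 0)
    (hgap : ∀ y y', y ∉ A → y' ∈ H → gap ≤ g.dist y y')
    (hT : HasMaj (BlockNorm.ofBlocks g blk) (BlockNorm.ofBlocks g blk) T (fun y y' => c * Real.exp (-(δ * g.dist y y')))) :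
    HasMaj (BlockNorm.ofBlocks g blk) (BlockNorm.ofBlocks g blk) (mulOp a ∘ₗ T ∘ₗ mulOp b)
      (fun y y' => c * Real.exp (-((δ - ρ₁) * gap)) * Real.exp (-(ρ₁ * g.dist y y'))) := by
  classical
  have hMa := hasMaj_mulOp (g := g) blk (a := a) (m := fun y => ind Aᶜ y) (fun y => ind_nonneg _ _) fun x => by
    by_cases hx : blk x ∈ A
    · rw [haA x hx, abs_zero]; exact ind_nonneg _ _
    · unfold ind; rw [if_pos (Set.mem_compl hx)]; exact ha1 x
  have hMb := hasMaj_mulOp (g := g) blk (a := b) (m := fun y => ind H y) (fun y => ind_nonneg _ _) fun x => by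
    by_cases hx : blk x ∈ H
    · unfold ind; rw [if_pos hx]; exact hb1 x
    · rw [hbH x hx, abs_zero]; exact ind_nonneg _ _
  have h1 := hasMaj_comp_diag blk (fun y y' => mul_nonneg hc (Real.exp_nonneg _)) hT hMb
  have h2 := hasMaj_diag_comp blk (fun y => ind_nonneg Aᶜ y) hMa h1
  rw [← LinearMap.comp_assoc]
  refine h2.mono fun y y' => ?_
  by_cases hy : y ∈ A
  · have : ind Aᶜ y = 0 := by unfold ind; rw [if_neg (fun h => h hy)]
    rw [this, zero_mul]; positivity
  by_cases hy' : y' ∈ H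
  · have hg := hgap y y' hy hy'
    have hexp : Real.exp (-(δ * g.dist y y')) ≤ Real.exp (-((δ - ρ₁) * gap)) * Real.exp (-(ρ₁ * g.dist y y')) := by
      rw [← Real.exp_add]; exact Real.exp_le_exp.mpr (by nlinarith)
    calc ind Aᶜ y * (c * Real.exp (-(δ * g.dist y y')) * ind H y') ≤ 1 * (c * Real.exp (-(δ * g.dist y y')) * 1) := by
          refine mul_le_mul (ind_le_one _ _) (mul_le_mul_of_nonneg_left (ind_le_one _ _) (mul_nonneg hc (Real.exp_nonneg _))) ?_ zero_le_one
          exact mul_nonneg (mul_nonneg hc (Real.exp_nonneg _)) (ind_nonneg _ _)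
      _ = c * Real.exp (-(δ * g.dist y y')) := by ring
      _ ≤ c * (Real.exp (-((δ - ρ₁) * gap)) * Real.exp (-(ρ₁ * g.dist y y'))) := mul_le_mul_of_nonneg_left hexp hc
      _ = _ := by ring
  · have : ind H y' = 0 := by unfold ind; rw [if_neg hy']
    rw [this, mul_zero, mul_zero]; positivity

end Far

/-! ## §3 The input-localized remainder row with the margin split -/

section Row

variable {X : Type} [Fintype X] {g : B6.Geometry} (blk : X → g.Site) {σ cr : ℝ}

/-- ★★ **THE INPUT-LOCALIZED ROW OF `Δ_loc + N′` WITH THE MARGIN SPLIT**: the two-sided local row `[Δ_loc, M_h]∘N ≤ 1_S1_Sθ₁e^{−δd}`, the OUTPUT-cut commutator row `M_χ∘[N′, M_h]∘N ≤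
1_S1_Sθ₂e^{−δd}` (small with `[N′, M_h]`), the far sandwich `M_{1−χ}∘N′∘M_h ≤ θ₃e^{−ρ₁d}` (small in the margin) and the two-sided cut row `M_χ∘N ≤ 1_S1_Sβe^{−δd}`, under `M_h∘M_χ = M_h`
⟹ `[Δ_loc + N′, M_h]∘N ≤ 1_S(y′)·(θ₁ + θ₂ + θ₃βc_r)·e^{−ρd}` (`0 ≤ ρ ≤ δ`, `ρ + σ ≤ ρ₁`). [cite: Balaban1984PropagatorsI, (1.121) p.37, (1.128) p.38 (mechanism); Balaban1984PropagatorsII, (2.92)–(2.93) p.239, (2.134) p.247 (shapes)] -/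
theorem hasMaj_commOp_comp_of_add_cut_margin (htri : Triangle254 g) (hd : ∀ a b : g.Site, 0 ≤ g.dist a b) (hrow : RowSum g σ cr)
    {Δloc N' N : (X → ℝ) →ₗ[ℝ] (X → ℝ)} {h χ : X → ℝ} {S : Set g.Site} {θ₁ θ₂ θ₃ β δ ρ ρ₁ : ℝ}
    (hθ₁ : 0 ≤ θ₁) (hθ₂ : 0 ≤ θ₂) (hθ₃ : 0 ≤ θ₃) (hβ : 0 ≤ β) (hρ : 0 ≤ ρ) (hρδ : ρ ≤ δ) (hρ₁ : ρ + σ ≤ ρ₁) (hcut : mulOp h ∘ₗ mulOp χ = mulOp h)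
    (hKloc : HasMaj (BlockNorm.ofBlocks g blk) (BlockNorm.ofBlocks g blk) (commOp Δloc h ∘ₗ N) (fun y y' => ind S y * ind S y' * (θ₁ * Real.exp (-(δ * g.dist y y')))))
    (hC : HasMaj (BlockNorm.ofBlocks g blk) (BlockNorm.ofBlocks g blk) (mulOp χ ∘ₗ (commOp N' h ∘ₗ N)) (fun y y' => ind S y * ind S y' * (θ₂ * Real.exp (-(δ * g.dist y y')))))
    (hFar : HasMaj (BlockNorm.ofBlocks g blk) (BlockNorm.ofBlocks g blk) (mulOp (1 - χ) ∘ₗ N' ∘ₗ mulOp h) (fun y y' => θ₃ * Real.exp (-(ρ₁ * g.dist y y'))))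
    (hGc : HasMaj (BlockNorm.ofBlocks g blk) (BlockNorm.ofBlocks g blk) (mulOp χ ∘ₗ N) (fun y y' => ind S y * ind S y' * (β * Real.exp (-(δ * g.dist y y'))))) :
    HasMaj (BlockNorm.ofBlocks g blk) (BlockNorm.ofBlocks g blk) (commOp (Δloc + N') h ∘ₗ N)
      (fun y y' => ind S y' * ((θ₁ + θ₂ + θ₃ * β * cr) * Real.exp (-(ρ * g.dist y y')))) := by
  have t3 := hasMaj_comp_exp_in blk htri hd hrow hθ₃ hβ hρ hρδ hρ₁ hFar hGc
  rw [commOp_comp_eq_split_margin hcut, show mulOp (1 - χ) ∘ₗ (N' ∘ₗ (mulOp h ∘ₗ (mulOp χ ∘ₗ N))) = (mulOp (1 - χ) ∘ₗ N' ∘ₗ mulOp h) ∘ₗ (mulOp χ ∘ₗ N) by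
    simp only [LinearMap.comp_assoc]]
  refine (hKloc.add (hC.add t3)).mono fun y y' => ?_
  have hexp : Real.exp (-(δ * g.dist y y')) ≤ Real.exp (-(ρ * g.dist y y')) := Real.exp_le_exp.2 (by nlinarith [hd y y'])
  have hiy : ind S y ≤ 1 := ind_le_one S y
  have hiy0 : 0 ≤ ind S y := ind_nonneg S y
  have hiy'0 : 0 ≤ ind S y' := ind_nonneg S y'
  have hE0 : 0 ≤ Real.exp (-(ρ * g.dist y y')) := Real.exp_nonneg _
  have two_sided : ∀ θ : ℝ, 0 ≤ θ → ind S y * ind S y' * (θ * Real.exp (-(δ * g.dist y y'))) ≤ ind S y' * (θ * Real.exp (-(ρ * g.dist y y'))) := fun θ hθ => by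
    calc ind S y * ind S y' * (θ * Real.exp (-(δ * g.dist y y'))) ≤ ind S y * ind S y' * (θ * Real.exp (-(ρ * g.dist y y'))) :=
          mul_le_mul_of_nonneg_left (mul_le_mul_of_nonneg_left hexp hθ) (mul_nonneg hiy0 hiy'0)
      _ ≤ 1 * ind S y' * (θ * Real.exp (-(ρ * g.dist y y'))) := mul_le_mul_of_nonneg_right (mul_le_mul_of_nonneg_right hiy hiy'0) (mul_nonneg hθ hE0)
      _ = _ := by ring
  have h1 := two_sided θ₁ hθ₁
  have h2 := two_sided θ₂ hθ₂
  calc ind S y * ind S y' * (θ₁ * Real.exp (-(δ * g.dist y y'))) +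
        (ind S y * ind S y' * (θ₂ * Real.exp (-(δ * g.dist y y'))) + ind S y' * (θ₃ * β * cr * Real.exp (-(ρ * g.dist y y'))))
      ≤ ind S y' * (θ₁ * Real.exp (-(ρ * g.dist y y'))) + (ind S y' * (θ₂ * Real.exp (-(ρ * g.dist y y'))) + ind S y' * (θ₃ * β * cr * Real.exp (-(ρ * g.dist y y')))) := by
        linarith
    _ = _ := by ring

end Row

end Summit.QuantumFields.YangMills.BalabanUVNodes.N15.Gluing

end
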